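import Summits.HubbardSuperconductivity.HubbardSuperconductivity.Theorems.ThermalWedgeTwSeededEnsembleEquivalenceRCompressibilityOfNumberVariance
import Summits.HubbardSuperconductivity.HubbardSuperconductivity.Theorems.ThermalWedgeTwSeededEnsembleEquivalenceRUniqOfPairingSaturation

/-!
# Crux `TwSeededEnsembleEquivalenceR` (stmt-HubbardSuperconductivity-15581) FROM TWO CORRELATION-FUNCTION BOUNDS
# OF THE COLD SOURCED GIBBS STATE: normal number fluctuations (VAR_DIFF) and pairing saturation (SAT)

Support file (`--supports stmt-HubbardSuperconductivity-15581`; sorry-free; no definition).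

The end point of this seat's normal-form chain for the line `cold-floor-collapse` (slug `Sketch`): the route decl
`ThermalWedge.TwSeededEnsembleEquivalenceR` (thermal-window canonical/grand-canonical defect bound of the
`d`-wave-seeded weakly repulsive Hubbard torus) follows, kernel-checked, from two statements about correlation
functions of the FINITE-VOLUME Gibbs state of the `d`-wave-SOURCED torus `dWaveSourceTorus L U μ h` at the cold
slice `β = e^{a/U}`, each uniform in the side `L`:

* VAR_DIFF — normal number fluctuations: `Re⟨N̂²⟩ − (Re⟨N̂⟩)² ≤ C·L²` locally uniformly in `μ`
  (`…RCompressibilityOfNumberVariance`: ⟹ bounded compressibility ⟹ DIFF);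
* SAT — pairing saturation: the chord pair susceptibility `Re⟨Δ_d+Δ_dᴴ⟩_{√s}/(2√s·L²)` strictly decreases in the
  squared source `s` at a rate `c > 0` (`…RUniqOfPairingSaturation`: ⟹ strict `s`-concavity of the limit ⟹ UNIQ′);

composed with the lead's `twR_of_coldDiff_coldUniq` (…ROfColdDiffUniq). Both are exactly the kind of statement a
convergent multiscale expansion for the sourced torus delivers (bounds on truncated two-point functions, uniform in
the volume); neither quantifies over a limit object. [folklore composition]
-/

set_option linter.dupNamespace false

namespace Summit.HubbardSuperconductivity.HubbardSuperconductivity.Theorems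

open Matrix Set Literature.MathematicalPhysics.QuantumLattice
open Summit.HubbardSuperconductivity.HubbardSuperconductivity.Theses.ThermalWedge
open Summit.HubbardSuperconductivity.HubbardSuperconductivity.Theorems.TwSeededEnsembleEquivalenceR.ColdFloorLine
open scoped ComplexOrder

noncomputable section

/-- **Crux R from normal number fluctuations and pairing saturation of the cold sourced Gibbs state.**
VAR_DIFF → SAT → `ThermalWedge.TwSeededEnsembleEquivalenceR`
(`twR_of_coldDiff_coldUniq` ∘ (`nvc_stub_sourcedColdDiff_of_numberVariance`,
`ups_stub_sourcedColdUniq_of_pairingSaturation`)). [folklore composition] -/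
theorem twR_of_numberVariance_pairingSaturation :
    (∀ (μ₁ μ₂ : ℝ), -4 < μ₁ → μ₁ < μ₂ → μ₂ < 0 → ∃ a₀ : ℝ, 0 < a₀ ∧ ∀ a ∈ Set.Ioc (0 : ℝ) a₀,
      ∃ K' U₀ : ℝ, 0 < K' ∧ 0 < U₀ ∧ ∀ U ∈ Set.Ioc (0 : ℝ) U₀, ∀ g ∈ Set.Icc (K' * U) (1 / 10),
        ∀ μ ∈ Set.Ioo μ₁ μ₂, ∀ h ∈ Set.Icc (-(13 * g + 1)) (13 * g + 1),
          ∃ C t₀ : ℝ, 0 < t₀ ∧ ∃ L₀ : ℕ, ∀ (L : ℕ) [NeZero L], L₀ ≤ L →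
            ∀ μ' ∈ Set.Icc (μ - t₀) (μ + t₀),
              (Matrix.gibbsState (Real.exp (a / U)) (dWaveSourceTorus L U μ' h)
                    (totalNumber * totalNumber)).re -
                  (Matrix.gibbsState (Real.exp (a / U)) (dWaveSourceTorus L U μ' h) totalNumber).re ^ 2 ≤
                C * (L : ℝ) ^ 2) →
    (∀ (μ₁ μ₂ : ℝ), -4 < μ₁ → μ₁ < μ₂ → μ₂ < 0 → ∃ a₁ : ℝ, 0 < a₁ ∧ ∀ a ∈ Set.Ioc (0 : ℝ) a₁,
      ∃ K' U₀ : ℝ, 0 < K' ∧ 0 < U₀ ∧ ∀ U ∈ Set.Ioc (0 : ℝ) U₀, ∀ g ∈ Set.Icc (K' * U) (1 / 10),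
        ∀ μ ∈ Set.Ioo μ₁ μ₂, ∃ c : ℝ, 0 < c ∧ ∃ L₀ : ℕ, ∀ (L : ℕ) [NeZero L], L₀ ≤ L →
          ∀ s s' : ℝ, 0 < s → s < s' → s' < (13 * g + 1) ^ 2 →
            c * (s' - s) ≤
              (Matrix.gibbsState (Real.exp (a / U)) (dWaveSourceTorus L U μ (Real.sqrt s))
                    (pairField dWaveFormFactor L + (pairField dWaveFormFactor L)ᴴ)).re /
                  (2 * Real.sqrt s * (L : ℝ) ^ 2) -
                (Matrix.gibbsState (Real.exp (a / U)) (dWaveSourceTorus L U μ (Real.sqrt s'))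
                    (pairField dWaveFormFactor L + (pairField dWaveFormFactor L)ᴴ)).re /
                  (2 * Real.sqrt s' * (L : ℝ) ^ 2)) →
    TwSeededEnsembleEquivalenceR := fun hV hS =>
  twR_of_coldDiff_coldUniq (nvc_stub_sourcedColdDiff_of_numberVariance hV)
    (ups_stub_sourcedColdUniq_of_pairingSaturation hS)

end

end Summit.HubbardSuperconductivity.HubbardSuperconductivity.Theorems
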